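import Summits.HodgeConjecture.HodgeCM.Model.Toy.Weil_1

/-! PORT of `HodgeCM/Model/Toy/Weil.lean` (HodgeCMPerL run 82) — part 2: continuation of `Summits.HodgeConjecture.HodgeCM.Model.Toy.Weil_1` (split at a top-level declaration boundary by port_pkg.py; scope re-opened below; declarations unchanged). -/

-- port_pkg: scope re-opened for this part (file-level context, then the namespace/section stack open at the cut)
noncomputable section
namespace HodgeCM.Toy
open Literature.AlgebraicGeometry.Motives
open Literature.AlgebraicGeometry.Motives.HodgeStructure (EndAction conj ofRat ofRat_apply complexConj
  mem_hodgeClasses_iff)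
open scoped TensorProduct
open exteriorPower CMPresentation Module
variable (D : HodgeData)
section M15
variable (K : CMField) (Φ : Fin 4 → CMType K)
/-! ### Lower bound: the trace-form descent `δ` -/

/-- `U = toyModelWith D` shorthands for the descent -/
def vv (i : Fin 4) (m : Fin (finrank ℚ (FK K))) :
    (toyModelWith D).Coh ((toyModelWith D).prod4 K Φ) 1 :=
  (toyModelWith D).pull ((toyModelWith D).pr4 K Φ i) 1 ((E1 K (Φ i)).symm (bF (FK K) m))

/-- the rational four-fold cup -/
def quad (a b c d : (toyModelWith D).Coh ((toyModelWith D).prod4 K Φ) 1) :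
    (toyModelWith D).Coh ((toyModelWith D).prod4 K Φ) 4 :=
  (toyModelWith D).cup _ 2 2 ((toyModelWith D).cup _ 1 1 a b) ((toyModelWith D).cup _ 1 1 c d)

/-- the index type of the descent sum -/
abbrev Q : Type := Fin (finrank ℚ (FK K)) × Fin (finrank ℚ (FK K)) × Fin (finrank ℚ (FK K)) × Fin (finrank ℚ (FK K))

/-- the rational classes `A_q = v⁰ ∪ v¹ ∪ v² ∪ v³` -/
def Acl (q : Q K) : (toyModelWith D).Coh ((toyModelWith D).prod4 K Φ) 4 :=
  quad D K Φ (vv D K Φ 0 q.2.2.2) (vv D K Φ 1 q.2.2.1) (vv D K Φ 2 q.2.1) (vv D K Φ 3 q.1)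

/-- `d_q = d_{m₀} d_{m₁} d_{m₂} d_{m₃} ∈ FK K` -/
def dq (q : Q K) : FK K := dF (FK K) q.1 * dF (FK K) q.2.1 * (dF (FK K) q.2.2.1 * dF (FK K) q.2.2.2)

/-- **the trace-form descent** `δ(λ) = Σ_q Tr(λ d_q) A_q` -/
def delta : FK K →ₗ[ℚ] (toyModelWith D).Coh ((toyModelWith D).prod4 K Φ) 4 :=
  ∑ q : Q K, (Algebra.trace ℚ (FK K) ∘ₗ LinearMap.mulRight ℚ (dq K q)).smulRight (Acl D K Φ q)

/-- (Ported verbatim from the HodgeCMPerL package; no docstring in the source.) -/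
lemma delta_apply (x : FK K) :
    delta D K Φ x = ∑ q : Q K, Algebra.trace ℚ (FK K) (x * dq K q) • Acl D K Φ q := by
  simp [delta, LinearMap.sum_apply, LinearMap.smulRight_apply]

/-- `u_i(τ) = T⁻¹ ε_τ`, the `τ`-eigenvector on the `i`-th corner (so `gen σ = u (embOf σ)`) -/
def uu (i : Fin 4) (τ : FK K →+* ℂ) : (toyModelWith D).CohC ((toyModelWith D).cmAV K (Φ i)) 1 :=
  (T K (Φ i)).symm (eps (FK K) τ)

/-- `g'_τ` : the Weil generator indexed by an embedding of `FK K` -/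
def g' (τ : FK K →+* ℂ) : (toyModelWith D).CohC ((toyModelWith D).prod4 K Φ) 4 :=
  (toyModelWith D).quadC _
    ((toyModelWith D).pullC ((toyModelWith D).pr4 K Φ 0) 1 (uu D K Φ 0 τ))
    ((toyModelWith D).pullC ((toyModelWith D).pr4 K Φ 1) 1 (uu D K Φ 1 τ))
    ((toyModelWith D).pullC ((toyModelWith D).pr4 K Φ 2) 1 (uu D K Φ 2 τ))
    ((toyModelWith D).pullC ((toyModelWith D).pr4 K Φ 3) 1 (uu D K Φ 3 τ))

/-- (Ported verbatim from the HodgeCMPerL package; no docstring in the source.) -/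
lemma g'_embOf (σ : K →+* ℂ) : g' D K Φ (embOf K σ) = g D K Φ σ := rfl

set_option synthInstance.maxHeartbeats 200000 in
/-- (Ported verbatim from the HodgeCMPerL package; no docstring in the source.) -/
lemma uu_expand (i : Fin 4) (τ : FK K →+* ℂ) :
    uu D K Φ i τ = ∑ m, (τ (dF (FK K) m) : ℂ) • ofRat ((E1 K (Φ i)).symm (bF (FK K) m)) := by
  rw [uu, eps, map_sum]
  refine Finset.sum_congr rfl fun m _ => ?_
  rw [LinearEquiv.symm_apply_eq, LinearEquiv.map_smul, ofRat_apply, T_apply, LinearMap.baseChange_tmul,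
    LinearEquiv.coe_coe, LinearEquiv.apply_symm_apply, TensorProduct.smul_tmul', smul_eq_mul, mul_one]

/-- (Ported verbatim from the HodgeCMPerL package; no docstring in the source.) -/
lemma pullC_ofRat {X Y : Obj} (f : Obj.Hom X Y) (k : ℕ) (y : ↥(⋀[ℚ]^k Y.L)) :
    (toyModelWith D).pullC f k (ofRat y) = ofRat ((toyModelWith D).pull f k y) := by
  simp [Universe.pullC, LinearMap.baseChange_tmul]

/-- (Ported verbatim from the HodgeCMPerL package; no docstring in the source.) -/
lemma cup2C_ofRat (X : Obj) (k : ℕ) (a b : ↥(⋀[ℚ]^k X.L)) :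
    (toyModelWith D).cup2C X k (ofRat a) (ofRat b) = ofRat ((toyModelWith D).cup X k k a b) := by
  simp [Universe.cup2C, LinearMap.BilinMap.baseChange_tmul]

/-- (Ported verbatim from the HodgeCMPerL package; no docstring in the source.) -/
lemma g'_expand (τ : FK K →+* ℂ) :
    g' D K Φ τ = ∑ q : Q K, (τ (dq K q) : ℂ) • ofRat (Acl D K Φ q) := by
  simp only [g', uu_expand, map_sum, map_smul, Universe.quadC, LinearMap.sum_apply,
    LinearMap.smul_apply, Finset.smul_sum, smul_smul, Fintype.sum_prod_type, dq, Acl, quad, vv,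
    map_mul, ofRat_apply, Universe.pullC, Universe.cup2C, LinearMap.baseChange_tmul,
    LinearMap.BilinMap.baseChange_tmul, mul_one]

/-- **complexification of the descent**: `δ(λ) ⊗ 1 = Σ_τ τ(λ) g'_τ` -/
lemma ofRat_delta (x : FK K) :
    ofRat (delta D K Φ x) = ∑ τ : FK K →+* ℂ, (τ x : ℂ) • g' D K Φ τ := by
  rw [delta_apply, map_sum]
  simp only [g'_expand, Finset.smul_sum, smul_smul, map_smul]
  rw [Finset.sum_comm]
  refine Finset.sum_congr rfl fun q _ => ?_
  rw [← Finset.sum_smul, ← Rat.cast_smul_eq_qsmul ℂ, trace_eq_sum_ringHom]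
  simp only [map_mul]

/-- (Ported verbatim from the HodgeCMPerL package; no docstring in the source.) -/
lemma delta_mem (x : FK K) : delta D K Φ x ∈ (toyModelWith D).weilLine K Φ := by
  change ofRat (delta D K Φ x) ∈ Submodule.span ℂ ((toyModelWith D).weilGenerators K Φ)
  rw [ofRat_delta, ← Equiv.sum_comp (embEquiv K).symm]
  exact Submodule.sum_mem _ fun σ _ =>
    Submodule.smul_mem _ _ (Submodule.subset_span (g_mem_weilGenerators D K Φ σ))

/-- (Ported verbatim from the HodgeCMPerL package; no docstring in the source.) -/
lemma delta_injective : Function.Injective (delta D K Φ) := by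
  refine (injective_iff_map_eq_zero _).mpr fun x hx => ?_
  have h := congrArg ofRat hx
  rw [map_zero, ofRat_delta, ← Equiv.sum_comp (embEquiv K).symm] at h
  have hli := Fintype.linearIndependent_iff.mp (linearIndependent_g D K Φ)
    (fun σ => ((embEquiv K).symm σ x : ℂ)) h
  have h0 := hli (σ₀ K : K →+* ℂ)
  exact (map_eq_zero_iff _ ((embEquiv K).symm (σ₀ K : K →+* ℂ)).injective).mp h0

/-- **Lower bound** `[K:ℚ] ≤ dim_ℚ W_K`. -/
theorem le_finrank_weilLine : finrank ℚ K ≤ finrank ℚ ((toyModelWith D).weilLine K Φ) := by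
  have h1 : finrank ℚ (LinearMap.range (delta D K Φ)) = finrank ℚ (FK K) :=
    LinearMap.finrank_range_of_inj (delta_injective D K Φ)
  have h2 : LinearMap.range (delta D K Φ) ≤ (toyModelWith D).weilLine K Φ := by
    rintro _ ⟨x, rfl⟩
    exact delta_mem D K Φ x
  calc finrank ℚ K = finrank ℚ (FK K) := (finrank_FK K).symm
    _ = _ := h1.symm
    _ ≤ _ := Submodule.finrank_mono h2

end M15

/-- **M15 (`Fact_weilLine_rank`) holds in the exterior model**: the Weil line of
`A_{Φ₀} × ⋯ × A_{Φ₃}` has `ℚ`-dimension exactly `[K:ℚ]`. [Weil 1977; dLP Lemma 2.1] -/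
theorem fact_weilLine_rank : (toyModelWith D).Fact_weilLine_rank := by
  intro K Φ
  apply le_antisymm
  · calc finrank ℚ ((toyModelWith D).weilLine K Φ) ≤ Fintype.card (K →+* ℂ) := finrank_weilLine_le D K Φ
      _ = finrank ℚ K := NumberField.Embeddings.card K ℂ
  · exact le_finrank_weilLine D K Φ



end HodgeCM.Toy

end
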